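import Summits.BirchSwinnertonDyer.BirchSwinnertonDyer.Theorems.ManinLocalTwoThreeRelativeIharaElementary
import Summits.BirchSwinnertonDyer.BirchSwinnertonDyer.Theorems.ManinLocalTwoThreeCongruenceHomShiftInvariant
import Summits.BirchSwinnertonDyer.BirchSwinnertonDyer.Theorems.ConjSpanGenAllLevelsDecomposition
import HarnessLib

/-!
# LEMMA G (E-es-31, MEMO-es §23.1), part 1/2: descent of a shift-stable subgroup of `SL₂(ℤ[1/t])` from `Γ₀(t^k L')` to
# `Γ₀(L')`, and the unipotents `U⁺(ℤ[1/t])`, `U⁻(L'ℤ[1/t])`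

Summit `BirchSwinnertonDyer`, cruxes C3 `ManinPrimeToThreeAtNine` (stmt-BirchSwinnertonDyer-22968) / C2 `ManinOddAtFour`
(stmt-22967), route `ManinLocalTwoThree` (cell bsd-f2-manin): the registered stubs `stub_relativeIharaBar331` /
`stub_relativeIharaBarTwo` are the leaf E-es-25 `RelativeIharaShiftVanishingBar p t n` (relative Ihara at a prime dividing
the level), whose fact-free proof plan (planner bsd-f2-manin-es g11, MEMO-es §23) has the elementary input LEMMA G:

  for a prime `t`, `n ≥ 1`, `L = t^k L'` with `t ∤ L'`, every subgroup `H ≤ SL₂(ℤ[1/t])` containing `ι Γ₀(L)` and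
  stable under the shifts `g ↦ A^{±n} g A^{∓n}` (`A = diag(t,1)`; on entries `(α, β; γ, δ) ↦ (α, t^{±n}β; t^{∓n}γ, δ)`)
  contains `Δ_t(L') = {g ∈ SL₂(ℤ[1/t]) : γ ∈ L'ℤ[1/t]}` (cell bsd-f3-mu's `ConjSpanGenAllLevels.Delta t L'`).

This file and its sequel `…ShiftClosureDelta.lean` PROVE it (`delta_le_of_gamma0Image_le_of_shiftStable` there; here steps
(i)–(ii)), in bsd-f3-mu's `SL₂(ℤ[1/t])` vocabulary (`Away`,
`iota`, `upperUnip`, `lowerUnip`, `diagP`, `negOne`, `upperB`, `Delta`, `gamma0Image`) and BY NAME through their theorem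
`deltaEqGamma0MulUpper` (`Δ = ι Γ₀(L')·B⁺`, `t ∤ L'`).  The shift hypotheses are stated on ENTRIES (`g'₀₁ = t^n g₀₁`,
`t^n g'₁₀ = g₁₀`, diagonal unchanged — and the inverse shift), so that any typed form of the shift (the planner's
`shiftConj t n` / `shiftConjInv t n`) instantiates them by `rfl`.  Steps (MEMO-es §23.1): (i) DESCENT — the generation lemma
`⟨Γ₀(M t^n), A^n Γ₀(M t^n) A^{-n}⟩ = Γ₀(M)` (`range_degeneracyConj_one_sup_range_degeneracyConj_pow_eq_top`, the prime-power
version of the lead's landed `…_eq_top`) iterated down the `t`-part of the level gives `ι Γ₀(L') ≤ H`; (ii) `U⁺(ℤ[1/t]) ≤ H`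
and `U⁻(L'ℤ[1/t]) ≤ H` by un-shifting integral unipotents; (iii) `diag(t, 1/t) ∈ H` from the identity
`(1 0; −L'/t 1)·ι(t b; L' d)·(1 −b/t; 0 1) = diag(t, 1/t)` (`t d − b L' = 1`); (iv) `B⁺ ≤ H` (units of `ℤ[1/t]` are
`±t^ℤ`); (v) `Δ_t(L') = ι Γ₀(L')·B⁺ ≤ H`.  Nothing about BSD or Manin's conjecture is proved here.
-/

set_option autoImplicit false
set_option linter.dupNamespace false

open scoped MatrixGroups

open CongruenceSubgroup Literature.NumberTheory.EllipticCurves.ModularForms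
  Summit.BirchSwinnertonDyer.BirchSwinnertonDyer.Theorems.ConjSpanGenAllLevels

namespace Summit.BirchSwinnertonDyer.BirchSwinnertonDyer.Theorems.ManinLocalTwoThree

/-! ### (i) Generation one level down by a prime POWER shift -/

section Generation

variable {M L t n : ℕ} [NeZero t]

/-- **Generation one level down, prime-power shift** (`d = t^n`, `t` prime, `n ≥ 1`, `L = M t^n`): the subgroups `Γ₀(L)`
and `diag(t^n,1) Γ₀(L) diag(t^n,1)⁻¹ = Γ₀(M) ∩ Γ⁰(t^n)` generate `Γ₀(M)` (same proof as the lead's `t`-version: `x ∈ {0,1}`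
makes `a + x c` prime to `t`, hence to `t^n`; Bézout modulo `t^n`). [folklore] -/
theorem range_degeneracyConj_one_sup_range_degeneracyConj_pow_eq_top (htp : t.Prime) (h₁ : M * 1 ∣ L)
    (ht : M * t ^ n ∣ L) (hL : L ∣ M * t ^ n) :
    (Gamma0.degeneracyConj M L 1 h₁).range ⊔ (Gamma0.degeneracyConj M L (t ^ n) ht).range = ⊤ := by
  rw [eq_top_iff]
  intro γ _
  set S : Subgroup (Gamma0 M) :=
    (Gamma0.degeneracyConj M L 1 h₁).range ⊔ (Gamma0.degeneracyConj M L (t ^ n) ht).range with hS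
  let Tm : ℤ → SL(2, ℤ) := fun x ↦ ⟨!![1, x; 0, 1], by rw [Matrix.det_fin_two_of]; ring⟩
  let T : ℤ → Gamma0 M := fun x ↦ ⟨Tm x, mem_Gamma0_of_apply_one_zero_eq_zero M (Tm x) rfl⟩
  have hT : ∀ x, T x ∈ S := by
    intro x
    refine Subgroup.mem_sup_left ⟨⟨Tm x, mem_Gamma0_of_apply_one_zero_eq_zero L (Tm x) rfl⟩, ?_⟩
    apply Subtype.ext
    rw [Gamma0.coe_degeneracyConj_one]
  set a : ℤ := (γ : SL(2, ℤ)) 0 0 with ha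
  set b : ℤ := (γ : SL(2, ℤ)) 0 1 with hb
  set c : ℤ := (γ : SL(2, ℤ)) 1 0 with hc
  set d : ℤ := (γ : SL(2, ℤ)) 1 1 with hd
  have hdet : a * d - b * c = 1 := by
    have h := Matrix.det_fin_two (γ : SL(2, ℤ)).1
    rw [(γ : SL(2, ℤ)).2] at h
    rw [ha, hb, hc, hd]; linarith
  obtain ⟨x, hx⟩ : ∃ x : ℤ, ¬ (t : ℤ) ∣ a + x * c := by
    by_cases hta : (t : ℤ) ∣ a
    · refine ⟨1, fun h ↦ ?_⟩
      have htc : (t : ℤ) ∣ c := by simpa using (dvd_sub h hta)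
      have : (t : ℤ) ∣ 1 := by
        rw [← hdet]
        exact dvd_sub (hta.mul_right d) (htc.mul_left b)
      exact htp.one_lt.ne' (by exact_mod_cast Int.eq_one_of_dvd_one (by positivity) this)
    · exact ⟨0, by simpa using hta⟩
  obtain ⟨u, hu⟩ : ∃ u : ℤ, ((t : ℤ) ^ n) ∣ (a + x * c) * u + (b + x * d) := by
    have hcop : IsCoprime ((t : ℤ) ^ n) (a + x * c) :=
      IsCoprime.pow_left ((Prime.coprime_iff_not_dvd (Nat.prime_iff_prime_int.mp htp)).mpr hx)
    obtain ⟨q, p, hpq⟩ := hcop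
    refine ⟨-(b + x * d) * p, ⟨(b + x * d) * q, ?_⟩⟩
    linear_combination (-(b + x * d)) * hpq
  have hγ₂ : T x * γ * T u ∈ S := by
    haveI : NeZero (t ^ n) := ⟨pow_ne_zero n (NeZero.ne t)⟩
    refine Subgroup.mem_sup_right ((mem_range_degeneracyConj_iff_dvd ht hL _).mpr ?_)
    have : ((T x * γ * T u : Gamma0 M) : SL(2, ℤ)) 0 1 = (a + x * c) * u + (b + x * d) := by
      simp only [Subgroup.coe_mul, Matrix.SpecialLinearGroup.coe_mul, T, Tm, ha, hb, hc, hd]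
      rw [Matrix.mul_apply, Fin.sum_univ_two, Matrix.mul_apply, Matrix.mul_apply, Fin.sum_univ_two,
        Fin.sum_univ_two]
      simp
    rw [this]
    exact_mod_cast hu
  have key : γ = (T x)⁻¹ * (T x * γ * T u) * (T u)⁻¹ := by group
  rw [key]
  exact S.mul_mem (S.mul_mem (S.inv_mem (hT x)) hγ₂) (S.inv_mem (hT u))

end Generation


/-! ### (i') Descent in `SL₂(ℤ[1/t])`: a shift-stable `H ⊇ ι Γ₀(t^k L')` contains `ι Γ₀(L')` -/

section Descent

variable {t n : ℕ} [NeZero t]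

omit [NeZero t] in
/-- `Γ₀(N') ≤ Γ₀(N)` for `N ∣ N'`, transported to `SL₂(ℤ[1/t])` (plumbing). [folklore] -/
theorem gamma0Image_mono {N N' : ℕ} (h : N ∣ N') : gamma0Image t N' ≤ gamma0Image t N := by
  apply Subgroup.map_mono
  intro A hA
  rw [Gamma0_mem] at hA ⊢
  exact (ZMod.intCast_zmod_eq_zero_iff_dvd _ N).mpr
    ((Int.natCast_dvd_natCast.mpr h).trans ((ZMod.intCast_zmod_eq_zero_iff_dvd _ N').mp hA))

variable (H : Subgroup SL(2, Away t))

/-- **One descent step**: if `H ⊇ ι Γ₀(M t^n)` is stable under the shift `g ↦ A^n g A^{-n}` (entries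
`(α, t^n β; t^{-n} γ, δ)`), then `H ⊇ ι Γ₀(M)` — the generation lemma
`range_degeneracyConj_one_sup_range_degeneracyConj_pow_eq_top` pushed through `ι`. [folklore] -/
theorem gamma0Image_le_of_shiftStable (htp : t.Prime) {M : ℕ} (hM : gamma0Image t (M * t ^ n) ≤ H)
    (hS : ∀ g ∈ H, ∀ g' : SL(2, Away t), g' 0 0 = g 0 0 → g' 0 1 = (t : Away t) ^ n * g 0 1 →
      (t : Away t) ^ n * g' 1 0 = g 1 0 → g' 1 1 = g 1 1 → g' ∈ H) :
    gamma0Image t M ≤ H := by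
  haveI : NeZero (t ^ n) := ⟨pow_ne_zero n (NeZero.ne t)⟩
  have h₁ : M * 1 ∣ M * t ^ n := by rw [mul_one]; exact Dvd.intro _ rfl
  have ht : M * t ^ n ∣ M * t ^ n := dvd_refl _
  -- `K := ι⁻¹ H ∩ Γ₀(M)` as a subgroup of `Γ₀(M)` contains both generating ranges
  let K : Subgroup (Gamma0 M) := H.comap ((ConjSpanGenAllLevels.iota t).comp (Gamma0 M).subtype)
  have hKmem : ∀ γ : Gamma0 M, γ ∈ K ↔ ConjSpanGenAllLevels.iota t (γ : SL(2, ℤ)) ∈ H := fun γ ↦ by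
    rw [Subgroup.mem_comap, MonoidHom.comp_apply, Subgroup.subtype_apply]
  have hK1 : (Gamma0.degeneracyConj M (M * t ^ n) 1 h₁).range ≤ K := by
    rintro _ ⟨δ, rfl⟩
    rw [hKmem, Gamma0.coe_degeneracyConj_one]
    exact hM ⟨δ, δ.2, rfl⟩
  have hKt : (Gamma0.degeneracyConj M (M * t ^ n) (t ^ n) ht).range ≤ K := by
    rintro _ ⟨δ, rfl⟩
    rw [hKmem]
    have hδ : ConjSpanGenAllLevels.iota t (δ : SL(2, ℤ)) ∈ H := hM ⟨δ, δ.2, rfl⟩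
    have hdiv : ((t : ℤ) ^ n) ∣ (δ : SL(2, ℤ)) 1 0 := by
      have h := δ.2
      rw [Gamma0_mem] at h
      have h' := (ZMod.intCast_zmod_eq_zero_iff_dvd _ (M * t ^ n)).mp h
      have e : ((M * t ^ n : ℕ) : ℤ) = (M : ℤ) * (t : ℤ) ^ n := by push_cast; ring
      exact (Dvd.intro_left (M : ℤ) e.symm).trans h'
    refine hS _ hδ _ ?_ ?_ ?_ ?_
    · simp [Gamma0.degeneracyConjElt]
    · simp [Gamma0.degeneracyConjElt]
    · have e := Int.mul_ediv_cancel' hdiv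
      have e' := congrArg (fun z : ℤ ↦ (z : Away t)) e
      simp only [Int.cast_mul, Int.cast_pow, Int.cast_natCast] at e'
      simpa [Gamma0.degeneracyConjElt] using e'
    · simp [Gamma0.degeneracyConjElt]
  have htop : (⊤ : Subgroup (Gamma0 M)) ≤ K := by
    rw [← range_degeneracyConj_one_sup_range_degeneracyConj_pow_eq_top htp h₁ ht (dvd_refl _)]
    exact sup_le hK1 hKt
  rintro _ ⟨γ, hγ, rfl⟩
  exact (hKmem ⟨γ, hγ⟩).mp (htop (Subgroup.mem_top (⟨γ, hγ⟩ : Gamma0 M)))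

/-- **Descent down the whole `t`-part of the level**: a shift-stable `H ⊇ ι Γ₀(t^k L')` contains `ι Γ₀(L')`.
[folklore] -/
theorem gamma0Image_le_of_shiftStable_pow (htp : t.Prime) (hn : 1 ≤ n) {L' : ℕ} (k : ℕ)
    (hk : gamma0Image t (t ^ k * L') ≤ H)
    (hS : ∀ g ∈ H, ∀ g' : SL(2, Away t), g' 0 0 = g 0 0 → g' 0 1 = (t : Away t) ^ n * g 0 1 →
      (t : Away t) ^ n * g' 1 0 = g 1 0 → g' 1 1 = g 1 1 → g' ∈ H) :
    gamma0Image t L' ≤ H := by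
  induction k using Nat.strong_induction_on with
  | _ k ih =>
  by_cases hkn : k ≤ n
  · -- `Γ₀(L' t^n) ≤ Γ₀(t^k L') ≤ H`, then one descent step
    apply gamma0Image_le_of_shiftStable H htp (M := L') _ hS
    refine le_trans (gamma0Image_mono ?_) hk
    exact Dvd.intro (t ^ (n - k)) (by rw [mul_comm (t ^ k) L', mul_assoc, ← pow_add, Nat.add_sub_cancel' hkn])
  · -- `t^k L' = (t^(k-n) L') t^n`: one descent step, then the induction hypothesis at `k - n < k`
    push Not at hkn
    have hk' : gamma0Image t (t ^ (k - n) * L' * t ^ n) ≤ H := by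
      have e : t ^ (k - n) * L' * t ^ n = t ^ k * L' := by
        rw [mul_comm, ← mul_assoc, ← pow_add, Nat.add_sub_cancel' hkn.le]
      rw [e]; exact hk
    exact ih (k - n) (by omega) (gamma0Image_le_of_shiftStable H htp hk' hS)

end Descent


/-! ### (ii) Unipotents `U⁺(ℤ[1/t])`, `U⁻(L'ℤ[1/t])` by un-shifting integral ones -/

section Unipotents

variable {t n : ℕ}

/-- The integral upper unipotent `ι(1 a; 0 1) = U⁺(a)` lies in `ι Γ₀(N)` (plumbing). [folklore] -/
theorem upperUnip_intCast_mem_gamma0Image (N : ℕ) (a : ℤ) :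
    upperUnip ((a : ℤ) : Away t) ∈ gamma0Image t N := by
  refine ⟨⟨!![1, a; 0, 1], by rw [Matrix.det_fin_two_of]; ring⟩,
    mem_Gamma0_of_apply_one_zero_eq_zero N _ rfl, ?_⟩
  ext i j
  fin_cases i <;> fin_cases j <;> simp [upperUnip]

/-- The integral lower unipotent `ι(1 0; N a 1) = U⁻(N a)` lies in `ι Γ₀(N)` (plumbing). [folklore] -/
theorem lowerUnip_intCast_mem_gamma0Image (N : ℕ) (a : ℤ) :
    lowerUnip ((N : Away t) * ((a : ℤ) : Away t)) ∈ gamma0Image t N := by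
  refine ⟨⟨!![1, 0; (N : ℤ) * a, 1], by rw [Matrix.det_fin_two_of]; ring⟩,
    mem_Gamma0_of_dvd_apply_one_zero _ (Dvd.intro a rfl), ?_⟩
  ext i j
  fin_cases i <;> fin_cases j <;> simp [lowerUnip]

variable (H : Subgroup SL(2, Away t))

/-- **`U⁺(ℤ[1/t]) ≤ H`**: `H ⊇ ι Γ₀(L')` stable under the inverse shift (which divides the upper-right entry by `t^n`)
contains every `(1 x; 0 1)`, `x ∈ ℤ[1/t]` (`n ≥ 1`). [folklore] -/
theorem upperUnip_mem_of_shiftStable (hn : 1 ≤ n) {L' : ℕ} (hΓ : gamma0Image t L' ≤ H)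
    (hS' : ∀ g ∈ H, ∀ g' : SL(2, Away t), g' 0 0 = g 0 0 → (t : Away t) ^ n * g' 0 1 = g 0 1 →
      g' 1 0 = (t : Away t) ^ n * g 1 0 → g' 1 1 = g 1 1 → g' ∈ H) (x : Away t) :
    upperUnip x ∈ H := by
  -- `(t^n)^j · y = a ∈ ℤ ⟹ U⁺(y) ∈ H`, by induction on `j`
  have key : ∀ (j : ℕ) (a : ℤ) (y : Away t), ((t : Away t) ^ n) ^ j * y = (a : Away t) → upperUnip y ∈ H := by
    intro j
    induction j with
    | zero =>
      intro a y hy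
      rw [pow_zero, one_mul] at hy
      rw [hy]; exact hΓ (upperUnip_intCast_mem_gamma0Image L' a)
    | succ j ih =>
      intro a y hy
      have h' : ((t : Away t) ^ n) ^ j * ((t : Away t) ^ n * y) = (a : Away t) := by
        rw [← hy, pow_succ]; ring
      refine hS' _ (ih a _ h') _ ?_ ?_ ?_ ?_ <;> simp [upperUnip]
  -- write `x = x₀ / t^e` and take `j = e`
  obtain ⟨e, x₀, _, hx, -⟩ := exists_common_denom (p := t) x 0
  refine key e (x₀ * (t : ℤ) ^ (e * (n - 1))) x ?_
  have hn' : n = (n - 1) + 1 := by omega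
  push_cast
  rw [← hx]
  conv_lhs => rw [hn']
  ring

/-- **`U⁻(L'ℤ[1/t]) ≤ H`**: `H ⊇ ι Γ₀(L')` stable under the shift (which divides the lower-left entry by `t^n`)
contains every `(1 0; L' y 1)`, `y ∈ ℤ[1/t]`. [folklore] -/
theorem lowerUnip_mem_of_shiftStable (hn : 1 ≤ n) {L' : ℕ} (hΓ : gamma0Image t L' ≤ H)
    (hS : ∀ g ∈ H, ∀ g' : SL(2, Away t), g' 0 0 = g 0 0 → g' 0 1 = (t : Away t) ^ n * g 0 1 →
      (t : Away t) ^ n * g' 1 0 = g 1 0 → g' 1 1 = g 1 1 → g' ∈ H) (y : Away t) :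
    lowerUnip ((L' : Away t) * y) ∈ H := by
  have key : ∀ (j : ℕ) (a : ℤ) (y : Away t), ((t : Away t) ^ n) ^ j * y = (a : Away t) →
      lowerUnip ((L' : Away t) * y) ∈ H := by
    intro j
    induction j with
    | zero =>
      intro a y hy
      rw [pow_zero, one_mul] at hy
      rw [hy]; exact hΓ (lowerUnip_intCast_mem_gamma0Image L' a)
    | succ j ih =>
      intro a y hy
      have h' : ((t : Away t) ^ n) ^ j * ((t : Away t) ^ n * y) = (a : Away t) := by
        rw [← hy, pow_succ]; ring
      refine hS _ (ih a _ h') _ ?_ ?_ ?_ ?_ <;> simp [lowerUnip]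
      ring
  obtain ⟨e, y₀, _, hy, -⟩ := exists_common_denom (p := t) y 0
  refine key e (y₀ * (t : ℤ) ^ (e * (n - 1))) y ?_
  have hn' : n = (n - 1) + 1 := by omega
  push_cast
  rw [← hy]
  conv_lhs => rw [hn']
  ring

end Unipotents


end Summit.BirchSwinnertonDyer.BirchSwinnertonDyer.Theorems.ManinLocalTwoThree
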